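import Literature.AnabelianGeometry.AbsoluteAnabelian.MLFGaloisMonoAnalyticModel
import Literature.AnabelianGeometry.AbsoluteAnabelian.GaloisPadicLogInstance
import Literature.AnabelianGeometry.AbsoluteAnabelian.GaloisPadicLogIntegers
import Summits.ABC.IUTFork.LanaLogLinkLifting
import Summits.ABC.IUTFork.LanaGoodPlace
import HarnessLib

/-!
# L-LANA objects IX ter: the side conditions of `LanaLogLinkLifting` at the `ℚ_p` reference datum (typing checks)

Vacuity-audit companion (D-0012; seat abc-iut-c312-4, L-LANA level) of `LanaLogLinkLifting.lean`; TAKES NO SIDE on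
[IUTchIII] Cor. 3.12. That file reduces LANA's "unique lifting" of the log-link (§5.3 (a) p. 29; [IUTchI] Cor. 5.3
(ii)) to [AbsTopIII] Prop. 3.2 (iv) BY NAME, under side conditions on the reference datum `F_v = (Π_v ↷ O^▷_v)`:
open stabilisers of `G_v ↷ O^▷_v` (so that `F_v` is an [AbsTopIII] Def. 3.1 (ii) pair, `RefLocalDatum.toPair`) and
characteristicity of the arithmetic kernel (`IsTopCharacteristic`). THIS file shows both are THEOREMS at the `ℚ_p`
reference datum `padicRef` of `LanaGoodPlace.lean` (`K̄_v = ℚ̄_p`, `G_v = Gal(ℚ̄_p/ℚ_p)`, placeholder `Π_v := G_v`):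

* `padicRef_stabilizer_isOpen` — Krull topology: stabilisers of algebraic elements are open (Mathlib
  `stabilizer_isOpen_of_isIntegral`); `padicPair` — the pair `(G_{ℚ_p} ↷ O^▷_{ℚ̄_p})`;
* `padicGal_eq_one_of_forall_smul_intMonoid` — `G_{ℚ_p}` acts FAITHFULLY on `O^▷_{ℚ̄_p}` (scale into the unit
  ball by powers of `p`); hence `padicPair_actionKer : actionKer = ⊥` and `padicPair_actionKer_isTopCharacteristic`;
* **`intMonoid_eq_nonzeroIntegers`** — LANA's `O^▷_{ℚ̄_p} = {0 < |a| ≤ 1}` IS [AbsTopIII] Def. 3.1 (i)'s `𝒪^⊳_{ℚ̄_p}`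
  (non-zero elements integral over `ℤ_p`; L4's `PadicAlgCl.mem_integersClosure_iff`), so **`padicPairIsoModel`**:
  LANA's Table-1 datum `F_v` at `ℚ_p` (with `Π_v := G_v`) IS ISOMORPHIC to L4's mono-analytic model `TM`-pair
  `(G_{ℚ_p} ↷ 𝒪^⊳_{ℚ̄_p})` (`ModelMLFGaloisData.galois … |>.tmPair` over `MLFClosure.padic`), whence
  **`isMLFGaloisMonoidPair_padicPair`** (the hypothesis `hMLF` of the reduction is a THEOREM here) and
  **`padicRef_liftUnique_of_pairIsoDeterminedByGalois`**: at the `ℚ_p` datum the uniqueness half of LANA's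
  unique lifting follows from [AbsTopIII] Prop. 3.2 (iv), injectivity (`PairIsoDeterminedByGalois`), ALONE.

HONEST SCOPE: the `ℚ_p` datum with `Π_v := G_v` is of mono-analytic, not hyperbolic-orbicurve, type — the anabelian
facts `PairIsoDeterminedByGalois` / `GaloisIsoLiftsToTMPairIso` are NOT exercised here; this is a typing check of
the side conditions, in the style of `LanaWitnesses` / `LanaRealHullChecks`. [cite: LANA2026Report, §5.3 (a) p. 29]
[cite: MochizukiAbsTopIII2015, Definition 3.1 (ii) p.67] NOT here: any judgement.
-/

noncomputable section

namespace Summit.ABC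
namespace IUTFork

open Literature.AnabelianGeometry.AbsoluteAnabelian
open scoped NNReal

section Padic

variable (p : ℕ) [Fact p.Prime]

/-- At the `ℚ_p` datum, `G_v = Gal(ℚ̄_p/ℚ_p)` acts on `O^▷_{ℚ̄_p}` with OPEN stabilisers (Krull topology: the
stabiliser of an algebraic element is open, Mathlib `stabilizer_isOpen_of_isIntegral`) — so `padicRef.toPair` is
available with no hypothesis. [cite: MochizukiAbsTopIII2015, Definition 3.1 (ii) p.67] -/
theorem padicRef_stabilizer_isOpen (a : intMonoid (padicVal p)) :
    IsOpen (MulAction.stabilizer (PadicGal p) a : Set (PadicGal p)) := by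
  have h : (MulAction.stabilizer (PadicGal p) a : Set (PadicGal p)) =
      (MulAction.stabilizer (PadicGal p) (a : PadicAlgCl p) : Set (PadicGal p)) := by
    ext σ
    simp only [SetLike.mem_coe, MulAction.mem_stabilizer_iff, Subtype.ext_iff, intMonoid.coe_smul]
  rw [h]
  exact stabilizer_isOpen_of_isIntegral (K := ℚ_[p]) (a : PadicAlgCl p)

/-- **The `ℚ_p` reference pair `(G_{ℚ_p} ↷ O^▷_{ℚ̄_p})`** as an [AbsTopIII] Def. 3.1 (ii) pair (typing check of
`RefLocalDatum.toPair`: its side condition is a theorem here). [cite: MochizukiAbsTopIII2015, Definition 3.1 (ii) p.67] -/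
abbrev padicPair : GaloisMonoidPair.{0} := (padicRef p).toPair (padicRef_stabilizer_isOpen p)

/-- `G_{ℚ_p}` acts FAITHFULLY on `O^▷_{ℚ̄_p}`: an automorphism fixing every non-zero integer fixes `ℚ̄_p`
(every `x` is `p^{-n} · (p^n x)` with `|p^n x| ≤ 1` for `n ≫ 0`). [folklore] -/
theorem padicGal_eq_one_of_forall_smul_intMonoid (σ : PadicGal p)
    (h : ∀ a : intMonoid (padicVal p), σ • a = a) : σ = 1 := by
  -- `σ` fixes every element of absolute value `≤ 1`
  have hint : ∀ x : PadicAlgCl p, padicVal p x ≤ 1 → σ x = x := by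
    intro x hx
    by_cases hx0 : x = 0
    · rw [hx0, map_zero]
    · have hmem : x ∈ intMonoid (padicVal p) := by
        rw [mem_intMonoid_iff]
        exact ⟨pos_iff_ne_zero.mpr ((Valuation.ne_zero_iff _).mpr hx0), hx⟩
      have := congrArg (fun a : intMonoid (padicVal p) => (a : PadicAlgCl p)) (h ⟨x, hmem⟩)
      simpa [intMonoid.coe_smul, AlgEquiv.smul_def] using this
  refine AlgEquiv.ext fun x => ?_
  rw [AlgEquiv.one_apply]
  by_cases hx0 : x = 0
  · rw [hx0, map_zero]
  -- scale `x` into the unit ball by a power of `p`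
  have hp1 : padicVal p (p : PadicAlgCl p) < 1 := by
    have hp : (1 : ℝ≥0) < p := by exact_mod_cast (Fact.out : p.Prime).one_lt
    rw [padicVal, PadicAlgCl.valuation_p, one_div]
    exact inv_lt_one_of_one_lt₀ hp
  have hvx : 0 < padicVal p x := pos_iff_ne_zero.mpr ((Valuation.ne_zero_iff _).mpr hx0)
  obtain ⟨n, hn⟩ := exists_pow_lt_of_lt_one (inv_pos.mpr hvx) hp1
  have hle : padicVal p ((p : PadicAlgCl p) ^ n * x) ≤ 1 := by
    rw [map_mul, map_pow]
    have hlt : padicVal p (p : PadicAlgCl p) ^ n * padicVal p x < (padicVal p x)⁻¹ * padicVal p x :=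
      mul_lt_mul_of_pos_right hn hvx
    rw [inv_mul_cancel₀ hvx.ne'] at hlt
    exact hlt.le
  have key := hint _ hle
  rw [map_mul, map_pow, map_natCast] at key
  have hpn0 : ((p : PadicAlgCl p) ^ n) ≠ 0 :=
    pow_ne_zero n (Nat.cast_ne_zero.mpr (Fact.out : p.Prime).ne_zero)
  exact mul_left_cancel₀ hpn0 key

/-- Hence the arithmetic kernel of the `ℚ_p` pair is `Ker(id) = 1` … [cite: MochizukiAbsTopIII2015, Definition 3.1 (ii) p.67] -/
theorem padicPair_actionKer : (padicPair p).actionKer = ⊥ := by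
  rw [(padicRef p).toPair_actionKer_eq_ker (padicRef_stabilizer_isOpen p)
    (padicGal_eq_one_of_forall_smul_intMonoid p)]
  exact (MonoidHom.ker_eq_bot_iff _).mpr Function.injective_id

/-- … and is therefore (trivially) characteristic: the side condition `hker` of `liftExists_of_galoisIsoLifts` is
a THEOREM at the `ℚ_p` datum. (That datum is of mono-analytic, not hyperbolic-orbicurve, type: the anabelian facts
themselves are not exercised by it.) [cite: MochizukiEtTh2009, Def 3.3 p.72] -/
theorem padicPair_actionKer_isTopCharacteristic :
    Literature.AnabelianGeometry.EtaleTheta.IsTopCharacteristic (PadicGal p) (padicPair p).actionKer := by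
  intro φ
  rw [padicPair_actionKer, Subgroup.map_bot]

/-! ### The `ℚ_p` reference pair is L4's mono-analytic model `TM`-pair -/

/-- **LANA's `O^▷_{ℚ̄_p}` IS [AbsTopIII]'s `𝒪^⊳_{ℚ̄_p}`**: an element of `ℚ̄_p` has valuation in `(0, 1]` iff it is
non-zero and integral over `ℤ_p` (L4's `PadicAlgCl.mem_integersClosure_iff`: integral ⟺ `‖x‖ ≤ 1`).
[cite: MochizukiAbsTopIII2015, Definition 3.1 (i) p.66] [cite: LANA2026Report, §0.4 (b) p. 8] -/
theorem intMonoid_eq_nonzeroIntegers : intMonoid (padicVal p) = nonzeroIntegers ℚ_[p] (PadicAlgCl p) := by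
  ext x
  change 0 < Valued.v x ∧ Valued.v x ≤ 1 ↔ x ∈ integersClosure ℚ_[p] (PadicAlgCl p) ∧ x ≠ 0
  rw [PadicAlgCl.mem_integersClosure_iff, pos_iff_ne_zero, Valuation.ne_zero_iff]
  rw [and_comm]
  refine and_congr_left fun _ => ?_
  rw [PadicAlgCl.valuation_def, ← NNReal.coe_le_coe, coe_nnnorm, NNReal.coe_one]

/-- **LANA's `ℚ_p` datum `F_v = (G_{ℚ_p} ↷ O^▷_{ℚ̄_p})` ⥲ L4's mono-analytic model `TM`-pair `(G_k ↷ 𝒪^⊳_k̄)`**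
(`ModelMLFGaloisData.galois`, `ε_k = id`, over `k = ℚ_p`, `k̄ = ℚ̄_p`): identity on `G_{ℚ_p}`, the equality
`O^▷ = 𝒪^⊳` on the monoids, the same Galois action. [cite: MochizukiAbsTopIII2015, Definition 3.1 (ii) p.67]
[cite: LANA2026Report, §3.10 Table 1 p. 22] -/
def padicPairIsoModel :
    GaloisMonoidPair.Iso (ModelMLFGaloisData.galois ℚ_[p] (PadicAlgCl p)).tmPair (padicPair p) where
  isoPi := ContinuousMulEquiv.refl _
  isoM := MulEquiv.submonoidCongr (intMonoid_eq_nonzeroIntegers p).symm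
  smul_comm _ _ := Subtype.ext rfl

/-- **The `ℚ_p` reference pair is an MLF-Galois `TM`-pair** ([AbsTopIII] Def. 3.1 (ii), over
`MLFClosure.padic`): the hypothesis `hMLF` of `liftUnique_of_pairIsoDeterminedByGalois` is a THEOREM at this datum.
[cite: MochizukiAbsTopIII2015, Definition 3.1 (ii) p.67] -/
theorem isMLFGaloisMonoidPair_padicPair : IsMLFGaloisMonoidPair .TM (padicPair p) :=
  ⟨⟨MLFClosure.padic p, ModelMLFGaloisData.galois ℚ_[p] (PadicAlgCl p), _,
    (ModelMLFGaloisData.galois ℚ_[p] (PadicAlgCl p)).monoidPair_TM, ⟨padicPairIsoModel p⟩⟩⟩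

/-- **At the `ℚ_p` datum, the uniqueness half of LANA's unique lifting follows from [AbsTopIII] Prop. 3.2 (iv),
injectivity, ALONE**: granted `PairIsoDeterminedByGalois` (L4's named fact, not proved in the tree), an
automorphism of the GM-data `F_v = (G_{ℚ_p} ↷ O^▷_{ℚ̄_p})` is determined by its `G_{ℚ_p}`-component.
[cite: MochizukiAbsTopIII2015, Proposition 3.2 (iv) p.72] [cite: LANA2026Report, §5.3 (a) p. 29] -/
theorem padicRef_liftUnique_of_pairIsoDeterminedByGalois (hdet : PairIsoDeterminedByGalois) :
    (padicRef p).LiftUnique :=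
  (padicRef p).liftUnique_of_pairIsoDeterminedByGalois (padicRef_stabilizer_isOpen p)
    (isMLFGaloisMonoidPair_padicPair p) hdet

end Padic

end IUTFork

end Summit.ABC

end
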